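import Summits.Ventures.PercRepro.C041ZoneOCubeUnion

/-!
# The UNION LEMMA for any finite number of components (p6, gen 27; C-041.md §14 (c)–(d), «induction on the number
of components»)

Setting of `C041ZoneOCubeUnion`.  A family of `n` finite state types `S i` with predicates `v i`, `g i`, `h i`
(`G_t ⇒ valid`); the product `∀ i, S i` carries `valid = ∃ i, v i (σ i)`, `g = ∃ i, g i (σ i)`, `h = ∃ i, h i (σ i)`
(`ocwPi`).

* `union_lemma_pi` — if every component has a nonnegative weighted sum, so does the product; by induction on `n`
  through `Fin.consEquiv` (`S 0 × (∀ i : Fin n, S i.succ) ≃ ∀ i : Fin (n+1), S i`) and the two-component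
  `union_lemma`.  The empty product (`n = 0`) has the single state with no valid component, weight `0`.

This is the gluing «ZONE O-CUBE on every zone ⟹ (O-CUBE) on a hub core» of §14 (c) at the counting level, for any
number of zones.
-/

namespace PercRepro

namespace ZoneOCube

open Finset

/-- Equivalent propositions have equal indicators. -/
theorem ind_congr {p q : Prop} (h : p ↔ q) : ind p = ind q := by
  by_cases hp : p
  · rw [ind_of_true hp, ind_of_true (h.1 hp)]
  · rw [ind_of_false hp, ind_of_false (fun hq => hp (h.2 hq))]

/-- The weight only depends on the truth values of the three predicates. -/
theorem ocw_eq_of_iff {S T : Type*} {v g h : S → Prop} {v' g' h' : T → Prop} {σ : S} {τ : T}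
    (hv : v σ ↔ v' τ) (hg : g σ ↔ g' τ) (hh : h σ ↔ h' τ) : ocw v g h σ = ocw v' g' h' τ := by
  unfold ocw
  rw [ind_congr hv, ind_congr hg, ind_congr hh]

/-- The weight on a product of components, with `valid`, `g`, `h` the disjunctions over the components. -/
noncomputable def ocwPi {n : ℕ} {S : Fin n → Type*} (v g h : ∀ i, S i → Prop) (σ : ∀ i, S i) : ℤ :=
  ocw (fun σ : ∀ i, S i => ∃ i, v i (σ i)) (fun σ => ∃ i, g i (σ i)) (fun σ => ∃ i, h i (σ i)) σ

/-- The empty product: one state, weight `0`. -/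
theorem sum_ocwPi_zero {S : Fin 0 → Type*} [∀ i, Fintype (S i)] (v g h : ∀ i, S i → Prop) :
    0 ≤ ∑ σ : ∀ i, S i, ocwPi v g h σ := by
  apply Finset.sum_nonneg
  intro σ _
  unfold ocwPi ocw
  rw [ind_of_false (fun ⟨i, _⟩ => i.elim0)]
  simp

/-- A predicate `∃ i : Fin (n+1), p i (σ i)` on a cons-tuple splits into the head and the tail. -/
theorem exists_cons_iff {n : ℕ} {S : Fin (n + 1) → Type*} (p : ∀ i, S i → Prop) (x : S 0)
    (t : ∀ i : Fin n, S i.succ) :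
    (∃ i, p i (Fin.cons x t i)) ↔ p 0 x ∨ ∃ i : Fin n, p i.succ (t i) := by
  constructor
  · rintro ⟨i, hi⟩
    refine Fin.cases (fun h => Or.inl ?_) (fun j h => Or.inr ⟨j, ?_⟩) i hi
    · rwa [Fin.cons_zero] at h
    · rwa [Fin.cons_succ] at h
  · rintro (h | ⟨j, hj⟩)
    · exact ⟨0, by rwa [Fin.cons_zero]⟩
    · exact ⟨j.succ, by rwa [Fin.cons_succ]⟩

/-- **THE UNION LEMMA FOR `n` COMPONENTS**: if every component has `G_t ⇒ valid` and a nonnegative weighted sum, the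
product with the disjunctions has a nonnegative weighted sum. -/
theorem union_lemma_pi {n : ℕ} {S : Fin n → Type*} [∀ i, Fintype (S i)] (v g h : ∀ i, S i → Prop)
    (hg : ∀ i σ, g i σ → v i σ) (hh : ∀ i σ, h i σ → v i σ) (H : ∀ i, 0 ≤ ∑ σ, ocw (v i) (g i) (h i) σ) :
    0 ≤ ∑ σ : ∀ i, S i, ocwPi v g h σ := by
  induction n with
  | zero => exact sum_ocwPi_zero v g h
  | succ n ih =>
    have hsum : ∑ σ : ∀ i, S i, ocwPi v g h σ =
        ∑ p : S 0 × (∀ i : Fin n, S i.succ),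
          ocw (fun p : S 0 × (∀ i : Fin n, S i.succ) => v 0 p.1 ∨ ∃ i : Fin n, v i.succ (p.2 i))
            (fun p => g 0 p.1 ∨ ∃ i : Fin n, g i.succ (p.2 i))
            (fun p => h 0 p.1 ∨ ∃ i : Fin n, h i.succ (p.2 i)) p := by
      rw [← Fintype.sum_equiv (Fin.consEquiv S) (fun p => ocwPi v g h ((Fin.consEquiv S) p)) (ocwPi v g h)
        (fun _ => rfl)]
      refine Finset.sum_congr rfl fun p _ => ?_
      unfold ocwPi
      change ocw _ _ _ (Fin.cons p.1 p.2) = _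
      exact ocw_eq_of_iff (exists_cons_iff v p.1 p.2) (exists_cons_iff g p.1 p.2) (exists_cons_iff h p.1 p.2)
    rw [hsum]
    have ih' := ih (fun i => v i.succ) (fun i => g i.succ) (fun i => h i.succ) (fun i σ => hg _ σ)
      (fun i σ => hh _ σ) (fun i => H i.succ)
    unfold ocwPi at ih'
    exact union_lemma (hg 0) (hh 0) (fun t ⟨i, hi⟩ => ⟨i, hg _ _ hi⟩) (fun t ⟨i, hi⟩ => ⟨i, hh _ _ hi⟩) (H 0) ih'

end ZoneOCube

end PercRepro
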